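/-
COR-CM (cell pub-hodgecm2, stage 2 of the Hodge ladder) — PLANNER-A «mukey» ∕ COORDINATOR order 12:49Z (operator l.17567): **S-e′ = the FINAL-FORM successor END on the
LemD3⊕DelRec base** — the seven rows of ✔ N211 `Summit.HodgeConjecture.CorCM.D2Bridge.MuKeyIdentLemD3EndDelRec.hc_cm_of_printed_citations_muKey_ident_lemD3_delRec`
(`Summits/HodgeConjecture/CorCM/D2Bridge/ClosedPrintedMuKeyIdentLemD3DelRec.lean`, p379848, sha16 9727b1b836b6c458: {hDel, h21, hLiu418, h411, h413, hD3, hD1''} — no legs, no residual)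
with the `hLiu418` row carrying BOTH identification binders exactly as in the S-e edition `D2Bridge/ClosedPrintedMuKeyIdentDelRecConjOmega.lean` (pen mukey-p8, c3f7bdf0426b7b58):
the SPACE identification `(R', hR')` = VERBATIM the conclusion of ✔ R10 `Summit.HodgeConjecture.CorCM.D2Bridge.MuConjIdent.exists_recordSystemConj_X_sec42DataOf_levelOf_eq`
(module `HComp.RecordSystemConj`) and the ω-SIDE identification `hΩ` = VERBATIM the conclusion of Ω (M)
`Summit.HodgeConjecture.CorCM.HComp.OmegaConj.exists_uniformOmegaRep_conj_hermConj` (module `HComp.RecordSystemConjOmegaTwistModel`), BOTH DISCHARGED IN KERNEL inside the proof.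
Rows hDel ∕ h21 ∕ h411 ∕ h413 ∕ hD3 ∕ hD1'' are N211's bytes verbatim; hLiu418 is S-e's row verbatim; the proof is ONE application of ✔ N157
`Summit.HodgeConjecture.CorCM.D2Bridge.MuKeyIdentLemD3End.hc_cm_of_printed_citations_muKey_ident_lemD3` at `h := DelRec.exists_recordSystem_of_printed hDel` with the two
identification binders discharged by the theorems just named.  STANDALONE: this file does NOT import the S-e edition (same Ω-M trigger; filed in parallel).
GENERATED by `work/succ/gen_se_prime.py` from the tree N211 bytes and the S-e v3 bytes, not hand-copied.  THEOREMS ONLY; nothing landed is edited or restated;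
new declaration names in a new namespace.  Seat prover-pub-hodgecm2-mukey-p8-g2-0, 2026-08-24.
FRAMING: HC_CM is NOT proved unconditionally (the displayed citations are hypotheses); this file claims no pointer ∕ label ∕ count move; HELD — WORLD = C FINAL.
-/
import Summits.HodgeConjecture.CorCM.D2Bridge.ClosedPrintedMuKeyIdentLemD3
import Summits.HodgeConjecture.CorCM.DelRec.RecordSystemOfPrinted
import Summits.HodgeConjecture.CorCM.B01.Transposition.HComp.RecordSystemConj
import Summits.HodgeConjecture.CorCM.B01.Transposition.HComp.RecordSystemConjOmegaTwistModel
import HarnessLib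

/-!
# S-e′: the LemD3⊕DelRec END with BOTH identification binders on the [Liu21, Thm 4.18] row (space: conjugate record; ω-side: the blocks at `νᶜ` ARE the conjugate space's own [Def 4.11] carriers at `ν`)

* `diagonal_frameD_map_complexConj` — frame bookkeeping: `c(diag(frameD V)) = diag(frameD V)` (the `hJc` input of `HComp.OmegaConj.iotaVConj`).
* `hc_cm_of_printed_citations_muKey_ident_lemD3_delRecConjOmega` — the END.  DISPLAYED (7 Prop binders, 0 data binders): `hDel` ([Del79] 2.2.5 + Cor. 2.7.21 as printed),
  `h21` ([Shi98] 21.4 + [Cas]), `hLiu418` ([Liu21] Thm 4.18 AS PRINTED at the printed datum, under the binders `(R', hR')` and `hΩ`), `h411` ([Liu21] Def 4.11 ∕ Prop 4.13 carriers),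
  `h413` ([Liu21] Prop 4.13), `hD3` ([Liu21] Lem D.1 (3) as printed, indexed family), `hD1''` ([Liu21] Lem D.1 (1) as printed).  HC_CM is NOT proved unconditionally; nothing
  displayed is inhabited here; the two identification binders are NOT displayed hypotheses of the END — they are ∀-bound INSIDE the `hLiu418` row and supplied by kernel theorems.
[Liu2021] Thm 4.18, Def 4.11–4.12, Prop 4.13, Lem D.1; [Deligne1979ShimuraVarieties] 2.1.2–2.1.4, 2.2.4–2.2.5, Cor. 2.7.21; [Milne2005ShimuraVarieties] Def. 12.8, 12.10; [Kudla1996] V.3.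
-/

set_option autoImplicit false

noncomputable section

namespace Summit.HodgeConjecture.CorCM.D2Bridge.MuKeyIdentLemD3DelRecConjOmegaEnd

open scoped TensorProduct Matrix
open NumberField NumberField.InfinitePlace
open HodgeCM.Model HodgeCM.Model.LiuIndex HodgeCM.Model.TowerCarrier
open HodgeCM.Literature.Theta.LiuAlbaneseModuleDatum.D2Bridge (HcmPieces)
open Summit.HodgeConjecture.CorCM.Model
open Literature.AlgebraicGeometry.Motives (CMType)
open Literature.AlgebraicGeometry.HodgeTheory Literature.NumberTheory.Automorphic.PicardCM
open Literature.AlgebraicGeometry.ShimuraVarieties.UnitaryCanonicalModel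
open Literature.NumberTheory.ComplexMultiplication
open Literature.NumberTheory.Automorphic
open Literature.NumberTheory.Automorphic.IdeleClassGroup (toHeckeCharacter isUnitary_toHeckeCharacter galConj)
open Literature.NumberTheory.Automorphic.Liu2021 Literature.NumberTheory.Automorphic.Liu2021.AppendixC
open Literature.NumberTheory.Automorphic.Liu2021.AppendixC.RestOne
open Literature.NumberTheory.Automorphic.Liu2021.Def411WeilCarriers (lineOf locF Rep)
open Summit.HodgeConjecture.CorCM.Transposition.OmegaTransport (realUnit)
open HodgeCM.Model.ArchSideTerm (e₁)
open Literature.NumberTheory.GelbartRogawski1991 Literature.NumberTheory.GelbartRogawski1991.UnitaryDualPair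
open Literature.NumberTheory.GelbartRogawski1991.UnitaryDualPair.LocalSplitting (localMu norm_localMu continuous_localMu localMu_toLocalRing_eq_one_iff
  eq_of_forall_localMu_toHeckeCharacter_eq)
open Literature.RepresentationTheory Literature.RepresentationTheory.Liu2021
open Summit.HodgeConjecture.CorCM.Transposition
open Summit.HodgeConjecture.CorCM.D2Bridge.AdapterMuConj (muConj prop413AsPrinted_muConj def411_muConj nontrivial_omegaAt_muConj_rest)
open Summit.HodgeConjecture.CorCM.D2Bridge.MuKeyIdentEnd (hc_cm_of_printed_citations_muKey_ident)
open Summit.HodgeConjecture.CorCM.D2Bridge.MuKeyIdentLemD3End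

/-! ## frame bookkeeping for the ω-side binder: the frame of record is real -/

/-- `c(diag(frameD V)) = diag(frameD V)` — the diagonal frame of record is fixed by complex conjugation entrywise (`frameD_real`); this is
the `hJc` input of `HComp.OmegaConj.iotaVConj`. [folklore] -/
theorem diagonal_frameD_map_complexConj (F : HodgeCM.CMField) {ι₁ : F →+* ℂ} (V : HodgeCM.HermSpace3 F ι₁) :
    (Matrix.diagonal (frameD V)).map ((IsCMField.complexConj (HodgeCM.CMField.K F) :
        HodgeCM.CMField.K F ≃ₐ[↥(maximalRealSubfield (HodgeCM.CMField.K F))] HodgeCM.CMField.K F) :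
        HodgeCM.CMField.K F →+* HodgeCM.CMField.K F) = Matrix.diagonal (frameD V) := by
  rw [Matrix.diagonal_map (map_zero _)]
  exact congrArg Matrix.diagonal (funext (frameD_real V))

/-! ## The END on the LemD3⊕DelRec base with BOTH identification binders (space: conjugate record; ω-side: conjugate space's own carriers), both discharged in kernel -/

set_option synthInstance.maxHeartbeats 400000 in
set_option maxHeartbeats 8000000 in
/-- **S-e′ — the LemD3⊕DelRec successor END with BOTH identification binders on the [Liu 2021, Thm 4.18] row.**
Displayed rows = ✔ N211 `MuKeyIdentLemD3EndDelRec.hc_cm_of_printed_citations_muKey_ident_lemD3_delRec` verbatim (hDel ∕ h21 ∕ h411 ∕ h413 ∕ hD3 ∕ hD1''), except that the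
`hLiu418` row ([Liu21, Thm 4.18] AS PRINTED at the printed datum `D_print(a, ν)`) is read UNDER TWO ∀-BOUND IDENTIFICATION BINDERS, both stated as the VERBATIM conclusions of
tree theorems and DISCHARGED IN KERNEL in the proof: `(R', hR')` — the datum's tower of models IS the model functor of a Deligne record `R'` of the CONJUGATE
hermitian space `c(V)` along `ι₁` (✔ R10 `MuConjIdent.exists_recordSystemConj_X_sec42DataOf_levelOf_eq`); `hΩ` — for every CM type `Φ'`, every section `r'` with
`r'_ν(ε′) = −r_{νᶜ}(ε)` and every `χ′ = χ⁻¹`, the datum's block `𝕌_V.omega νᶜ (ε, χ)` is ℂ-linearly isomorphic, equivariantly along `g ↦ ḡ` (`HComp.OmegaConj.phiConj`), to the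
conjugate space's own [Def 4.11] carrier `𝕌_{c(V)}.omega ν (ε′, χ′)` (Ω (M) `HComp.OmegaConj.exists_uniformOmegaRep_conj_hermConj`).  KERNEL: ONE application of ✔ N157
`MuKeyIdentLemD3End.hc_cm_of_printed_citations_muKey_ident_lemD3` at `h := DelRec.exists_recordSystem_of_printed hDel`, its `hLiu418` supplied from the displayed row by
`obtain ⟨R', hR'⟩ := …exists_recordSystemConj_X_sec42DataOf_levelOf_eq …` and `hΩ := fun Φ' r' ε ε' hε χ χ' hχ => …exists_uniformOmegaRep_conj_hermConj …`.
HC_CM is NOT proved unconditionally: the displayed citations are hypotheses; whether this is a record is the COORDINATOR's ∕ referees' call.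
[cite: Liu2021, Thm 4.18 p. 52; Def 4.11–4.12 pp. 48–49; Prop 4.13 p. 50; App. D Lem D.1 pp. 86–87; App. C §C.1 and Rem. C.2]
[cite: Deligne1979ShimuraVarieties, §2.1.2–2.1.4, 2.2.4–2.2.5 and Cor. 2.7.21 (PDF pp. 24, 29, 52 of Milne's translation)]
[cite: Milne2005ShimuraVarieties, Def. 12.8 (62) p. 114; Def. 12.10 p. 115] [cite: Kudla1996, V.3] -/
theorem hc_cm_of_printed_citations_muKey_ident_lemD3_delRecConjOmega
    (hDel : Literature.AlgebraicGeometry.ShimuraVarieties.UnitaryCanonicalModel.canonicalModel_exists_printed)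
    (h21 : shimura1998_thm21_4_casselman)
    -- [Liu21, Thm 4.18] AS PRINTED at the PRINTED datum D_print(a, ν), UNDER TWO IDENTIFICATION BINDERS: (R', hR') = the conclusion of R10's `MuConjIdent.exists_recordSystemConj_X_sec42DataOf_levelOf_eq` VERBATIM (space: the datum's tower IS the conjugate record's model functor) and hΩ = the conclusion of Ω (M) `HComp.OmegaConj.exists_uniformOmegaRep_conj_hermConj` VERBATIM (blocks: 𝕌_V.omega νᶜ (ε,χ) ≃ₗ[ℂ], equivariantly along g ↦ ḡ, 𝕌_{V^(c)}.omega ν (ε′,χ′) for every section r′ with r′_ν(ε′) = −r(ε) and χ′ = χ⁻¹)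
    (hLiu418 : ∀ (F : HodgeCM.CMField) [IsGalois ℚ F] (h6 : 6 ≤ Module.finrank ℚ F) {ι₁ : F →+* ℂ} (V : HodgeCM.HermSpace3 F ι₁) (a : RealScalar F)
      (Φ : CMType F) (hΦ : ι₁ ∈ Φ.1) (ν : Literature.NumberTheory.Automorphic.IdeleClassGroup (F : Type) →ₜ* Circle)
      (hν : IdeleClassGroup.IsConjugateSymplectic (F : Type) ν) (hw : IdeleClassGroup.HasWeight (F : Type) ν 1)
      (R' : RecordSystem (HodgeCM.CMField.K F) (Summit.HodgeConjecture.CorCM.Model.RecordSystemConj.conjGram (HodgeCM.CMField.K F) (HodgeCM.HermSpace3.Hm V)) ι₁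
        (Summit.HodgeConjecture.CorCM.Model.RecordSystemConj.conjFrame (Summit.HodgeConjecture.CorCM.Model.frameOf (⟨HodgeCM.HermSpace3.Hm V, HodgeCM.HermSpace3.isHermitian V, HodgeCM.HermSpace3.signature_ι₁ V, HodgeCM.HermSpace3.posDef_of_ne V⟩ : Summit.HodgeConjecture.CorCM.HermSpace3 ⟨HodgeCM.CMField.K F⟩ ι₁)))
        (Summit.HodgeConjecture.CorCM.Model.RecordSystemConj.formCongr_conjFrame (HodgeCM.CMField.K F) (HodgeCM.HermSpace3.Hm V) ι₁ (Summit.HodgeConjecture.CorCM.Model.frameOf (⟨HodgeCM.HermSpace3.Hm V, HodgeCM.HermSpace3.isHermitian V, HodgeCM.HermSpace3.signature_ι₁ V, HodgeCM.HermSpace3.posDef_of_ne V⟩ : Summit.HodgeConjecture.CorCM.HermSpace3 ⟨HodgeCM.CMField.K F⟩ ι₁))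
          (Summit.HodgeConjecture.CorCM.Model.formCongr_frameOf (⟨HodgeCM.HermSpace3.Hm V, HodgeCM.HermSpace3.isHermitian V, HodgeCM.HermSpace3.signature_ι₁ V, HodgeCM.HermSpace3.posDef_of_ne V⟩ : Summit.HodgeConjecture.CorCM.HermSpace3 ⟨HodgeCM.CMField.K F⟩ ι₁)))
        (Summit.HodgeConjecture.CorCM.Model.RecordSystemConj.conjLevel₀ (HodgeCM.CMField.K F) (HodgeCM.HermSpace3.Hm V) (Summit.HodgeConjecture.CorCM.HComp.K3 (⟨HodgeCM.HermSpace3.Hm V, HodgeCM.HermSpace3.isHermitian V, HodgeCM.HermSpace3.signature_ι₁ V, HodgeCM.HermSpace3.posDef_of_ne V⟩ : Summit.HodgeConjecture.CorCM.HermSpace3 ⟨HodgeCM.CMField.K F⟩ ι₁))))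
      (hR' : CategoryTheory.Functor.comp (Summit.HodgeConjecture.CorCM.Model.RecordSystemConj.smallLevelConjBack (HodgeCM.CMField.K F) (HodgeCM.HermSpace3.Hm V) (Summit.HodgeConjecture.CorCM.HComp.K3 (⟨HodgeCM.HermSpace3.Hm V, HodgeCM.HermSpace3.isHermitian V, HodgeCM.HermSpace3.signature_ι₁ V, HodgeCM.HermSpace3.posDef_of_ne V⟩ : Summit.HodgeConjecture.CorCM.HermSpace3 ⟨HodgeCM.CMField.K F⟩ ι₁))) (Summit.HodgeConjecture.CorCM.Model.sec42DataOfFourLe (Summit.HodgeConjecture.CorCM.DelRec.exists_recordSystem_of_printed hDel) (⟨HodgeCM.HermSpace3.Hm V, HodgeCM.HermSpace3.isHermitian V, HodgeCM.HermSpace3.signature_ι₁ V, HodgeCM.HermSpace3.posDef_of_ne V⟩ : Summit.HodgeConjecture.CorCM.HermSpace3 ⟨HodgeCM.CMField.K F⟩ ι₁) Φ (le_trans (Nat.le_of_ble_eq_true rfl) h6) (isoOf ⟨HodgeCM.CMField.K F⟩ ι₁ (⟨HodgeCM.HermSpace3.Hm V, HodgeCM.HermSpace3.isHermitian V, HodgeCM.HermSpace3.signature_ι₁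 V, HodgeCM.HermSpace3.posDef_of_ne V⟩ : Summit.HodgeConjecture.CorCM.HermSpace3 ⟨HodgeCM.CMField.K F⟩ ι₁) Φ)).cpt.X = R'.M ∧
        ∀ K : Subgroup (Summit.HodgeConjecture.CorCM.Model.honestP5Of (Summit.HodgeConjecture.CorCM.DelRec.exists_recordSystem_of_printed hDel) ⟨HodgeCM.CMField.K F⟩ ι₁ ⟨HodgeCM.HermSpace3.Hm V, HodgeCM.HermSpace3.isHermitian V, HodgeCM.HermSpace3.signature_ι₁ V, HodgeCM.HermSpace3.posDef_of_ne V⟩ Φ).G,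
          (sec42DataOf (Summit.HodgeConjecture.CorCM.DelRec.exists_recordSystem_of_printed hDel) isoOf ⟨HodgeCM.CMField.K F⟩ ι₁ ⟨HodgeCM.HermSpace3.Hm V, HodgeCM.HermSpace3.isHermitian V, HodgeCM.HermSpace3.signature_ι₁ V, HodgeCM.HermSpace3.posDef_of_ne V⟩ Φ).X ((sec42DataOf (Summit.HodgeConjecture.CorCM.DelRec.exists_recordSystem_of_printed hDel) isoOf ⟨HodgeCM.CMField.K F⟩ ι₁ ⟨HodgeCM.HermSpace3.Hm V, HodgeCM.HermSpace3.isHermitian V, HodgeCM.HermSpace3.signature_ι₁ V, HodgeCM.HermSpace3.posDef_of_ne V⟩ Φ).levelOf K) =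
            R'.M.obj (⟨C5.OpenCompactSubgroup.transport (Summit.HodgeConjecture.CorCM.Model.RecordSystemConj.groupConj (HodgeCM.CMField.K F) (HodgeCM.HermSpace3.Hm V)) ((Summit.HodgeConjecture.CorCM.Model.sec42DataOfFourLe (Summit.HodgeConjecture.CorCM.DelRec.exists_recordSystem_of_printed hDel) (⟨HodgeCM.HermSpace3.Hm V, HodgeCM.HermSpace3.isHermitian V, HodgeCM.HermSpace3.signature_ι₁ V, HodgeCM.HermSpace3.posDef_of_ne V⟩ : Summit.HodgeConjecture.CorCM.HermSpace3 ⟨HodgeCM.CMField.K F⟩ ι₁) Φ (le_trans (Nat.le_of_ble_eq_true rfl) h6) (isoOf ⟨HodgeCM.CMField.K F⟩ ι₁ (⟨HodgeCM.HermSpace3.Hm V, HodgeCM.HermSpace3.isHermitian V, HodgeCM.HermSpace3.signature_ι₁ V, HodgeCM.HermSpace3.posDef_of_ne V⟩ : Summit.HodgeConjecture.CorCM.HermSpace3 ⟨HodgeCM.CMField.K F⟩ ι₁) Φ)).levelOf K).1,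
              C5.OpenCompactSubgroup.transport_mono (Summit.HodgeConjecture.CorCM.Model.RecordSystemConj.groupConj (HodgeCM.CMField.K F) (HodgeCM.HermSpace3.Hm V)) ((Summit.HodgeConjecture.CorCM.Model.sec42DataOfFourLe (Summit.HodgeConjecture.CorCM.DelRec.exists_recordSystem_of_printed hDel) (⟨HodgeCM.HermSpace3.Hm V, HodgeCM.HermSpace3.isHermitian V, HodgeCM.HermSpace3.signature_ι₁ V, HodgeCM.HermSpace3.posDef_of_ne V⟩ : Summit.HodgeConjecture.CorCM.HermSpace3 ⟨HodgeCM.CMField.K F⟩ ι₁) Φ (le_trans (Nat.le_of_ble_eq_true rfl) h6) (isoOf ⟨HodgeCM.CMField.K F⟩ ι₁ (⟨HodgeCM.HermSpace3.Hm V, HodgeCM.HermSpace3.isHermitian V, HodgeCM.HermSpace3.signature_ι₁ V, HodgeCM.HermSpace3.posDef_of_ne V⟩ : Summit.HodgeConjecture.CorCM.HermSpace3 ⟨HodgeCM.CMField.K F⟩ ι₁) Φ)).levelOf K).2⟩ :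
              C5.SmallLevel (Summit.HodgeConjecture.CorCM.Model.RecordSystemConj.conjLevel₀ (HodgeCM.CMField.K F) (HodgeCM.HermSpace3.Hm V) (Summit.HodgeConjecture.CorCM.HComp.K3 (⟨HodgeCM.HermSpace3.Hm V, HodgeCM.HermSpace3.isHermitian V, HodgeCM.HermSpace3.signature_ι₁ V, HodgeCM.HermSpace3.posDef_of_ne V⟩ : Summit.HodgeConjecture.CorCM.HermSpace3 ⟨HodgeCM.CMField.K F⟩ ι₁)))))
      (hΩ : ∀ (Φ' : CMType F)
        (r' : ∀ μ : Literature.NumberTheory.Automorphic.IdeleClassGroup (F : Type) →ₜ* Circle, IdeleClassGroup.IsConjugateSymplectic (F : Type) μ →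
          Rep ↥(maximalRealSubfield (HodgeCM.CMField.K F)) (imagUnitSq (HodgeCM.CMField.K F)))
        (ε ε' : Literature.NumberTheory.Automorphic.Liu2021.Def411WeilCarriers.Eps ↥(maximalRealSubfield (HodgeCM.CMField.K F)) (imagUnitSq (HodgeCM.CMField.K F)))
        (hε : (r' ν hν).toFun ε' = -(((fun _ _ => (Rep.update ↥(maximalRealSubfield (HodgeCM.CMField.K F)) (imagUnitSq (HodgeCM.CMField.K F)) (Rep.ofLineOf ↥(maximalRealSubfield (HodgeCM.CMField.K F)) (imagUnitSq (HodgeCM.CMField.K F))) (locF ↥(maximalRealSubfield (HodgeCM.CMField.K F)) (imagUnitSq (HodgeCM.CMField.K F)) (realUnit ⟨HodgeCM.CMField.K F⟩ a.1 a.2.1 a.2.2)) (realUnit ⟨HodgeCM.CMField.K F⟩ a.1 a.2.1 a.2.2) rfl)) (galConj (IsCMField.complexConj _) ν) hν.galConj).toFun ε))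
        (χ χ' : Literature.NumberTheory.Automorphic.Liu2021.Def411WeilCarriers.Chi ↥(maximalRealSubfield (HodgeCM.CMField.K F)) (HodgeCM.CMField.K F) (IsCMField.complexConj (HodgeCM.CMField.K F)))
        (hχ : χ'.1 = χ.1⁻¹),
        ∃ Ω : (uniformOmegaRep (Summit.HodgeConjecture.CorCM.DelRec.exists_recordSystem_of_printed hDel) ⟨HodgeCM.CMField.K F⟩ ι₁ ⟨HodgeCM.HermSpace3.Hm V, HodgeCM.HermSpace3.isHermitian V, HodgeCM.HermSpace3.signature_ι₁ V, HodgeCM.HermSpace3.posDef_of_ne V⟩ Φ e₁ (frameD V) (frameD_real V) (frameD_ne V) (ιVE V) (2 * imagUnit (HodgeCM.CMField.K F))⁻¹ (fun _ _ => (Rep.update ↥(maximalRealSubfield (HodgeCM.CMField.K F)) (imagUnitSq (HodgeCM.CMField.K F)) (Rep.ofLineOf ↥(maximalRealSubfield (HodgeCM.CMField.K F)) (imagUnitSq (HodgeCM.CMField.K F))) (locF ↥(maximalRealSubfield (HodgeCM.CMField.K F)) (imagUnitSq (HodgeCM.CMField.K F)) (realUnit ⟨HodgeCM.CMField.K F⟩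 a.1 a.2.1 a.2.2)) (realUnit ⟨HodgeCM.CMField.K F⟩ a.1 a.2.1 a.2.2) rfl))).omega (galConj (IsCMField.complexConj _) ν) hν.galConj ε χ ≃ₗ[ℂ] (uniformOmegaRep (Summit.HodgeConjecture.CorCM.DelRec.exists_recordSystem_of_printed hDel) ⟨HodgeCM.CMField.K F⟩ ι₁ (⟨HodgeCM.HermSpace3.Hm V, HodgeCM.HermSpace3.isHermitian V, HodgeCM.HermSpace3.signature_ι₁ V, HodgeCM.HermSpace3.posDef_of_ne V⟩ : Summit.HodgeConjecture.CorCM.HermSpace3 ⟨HodgeCM.CMField.K F⟩ ι₁).conj Φ' e₁ (frameD V) (frameD_real V) (frameD_ne V) (Summit.HodgeConjecture.CorCM.HComp.OmegaConj.iotaVConj (Summit.HodgeConjecture.CorCM.DelRec.exists_recordSystem_of_printed hDel) ⟨HodgeCM.CMField.K F⟩ ι₁ (⟨HodgeCM.HermSpace3.Hm V, HodgeCM.HermSpace3.isHermitian V, HodgeCM.HermSpace3.signature_ι₁ V, HodgeCM.HermSpace3.posDef_of_ne V⟩ : Summit.HodgeConjecture.CorCM.HermSpace3 ⟨HodgeCM.CMField.K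 F⟩ ι₁) Φ Φ' (frameD V) (ιVE V) (diagonal_frameD_map_complexConj F V)) (2 * imagUnit (HodgeCM.CMField.K F))⁻¹ r').omega ν hν ε' χ',
          ∀ (g : (sec42DataOf (Summit.HodgeConjecture.CorCM.DelRec.exists_recordSystem_of_printed hDel) isoOf ⟨HodgeCM.CMField.K F⟩ ι₁ ⟨HodgeCM.HermSpace3.Hm V, HodgeCM.HermSpace3.isHermitian V, HodgeCM.HermSpace3.signature_ι₁ V, HodgeCM.HermSpace3.posDef_of_ne V⟩ Φ).G) (x : (uniformOmegaRep (Summit.HodgeConjecture.CorCM.DelRec.exists_recordSystem_of_printed hDel) ⟨HodgeCM.CMField.K F⟩ ι₁ ⟨HodgeCM.HermSpace3.Hm V, HodgeCM.HermSpace3.isHermitian V, HodgeCM.HermSpace3.signature_ι₁ V, HodgeCM.HermSpace3.posDef_of_ne V⟩ Φ e₁ (frameD V) (frameD_real V) (frameD_ne V) (ιVE V) (2 * imagUnit (HodgeCM.CMField.K F))⁻¹ (fun _ _ => (Rep.update ↥(maximalRealSubfield (HodgeCM.CMField.K F)) (imagUnitSq (HodgeCM.CMField.K F)) (Rep.ofLineOf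 ↥(maximalRealSubfield (HodgeCM.CMField.K F)) (imagUnitSq (HodgeCM.CMField.K F))) (locF ↥(maximalRealSubfield (HodgeCM.CMField.K F)) (imagUnitSq (HodgeCM.CMField.K F)) (realUnit ⟨HodgeCM.CMField.K F⟩ a.1 a.2.1 a.2.2)) (realUnit ⟨HodgeCM.CMField.K F⟩ a.1 a.2.1 a.2.2) rfl))).omega (galConj (IsCMField.complexConj _) ν) hν.galConj ε χ),
            Ω ((uniformOmegaRep (Summit.HodgeConjecture.CorCM.DelRec.exists_recordSystem_of_printed hDel) ⟨HodgeCM.CMField.K F⟩ ι₁ ⟨HodgeCM.HermSpace3.Hm V, HodgeCM.HermSpace3.isHermitian V, HodgeCM.HermSpace3.signature_ι₁ V, HodgeCM.HermSpace3.posDef_of_ne V⟩ Φ e₁ (frameD V) (frameD_real V) (frameD_ne V) (ιVE V) (2 * imagUnit (HodgeCM.CMField.K F))⁻¹ (fun _ _ => (Rep.update ↥(maximalRealSubfield (HodgeCM.CMField.K F)) (imagUnitSq (HodgeCM.CMField.K F)) (Rep.ofLineOf ↥(maximalRealSubfield (HodgeCM.CMField.K F)) (imagUnitSq (HodgeCM.CMField.K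 F))) (locF ↥(maximalRealSubfield (HodgeCM.CMField.K F)) (imagUnitSq (HodgeCM.CMField.K F)) (realUnit ⟨HodgeCM.CMField.K F⟩ a.1 a.2.1 a.2.2)) (realUnit ⟨HodgeCM.CMField.K F⟩ a.1 a.2.1 a.2.2) rfl))).rho (galConj (IsCMField.complexConj _) ν) hν.galConj ε χ g x) =
              (uniformOmegaRep (Summit.HodgeConjecture.CorCM.DelRec.exists_recordSystem_of_printed hDel) ⟨HodgeCM.CMField.K F⟩ ι₁ (⟨HodgeCM.HermSpace3.Hm V, HodgeCM.HermSpace3.isHermitian V, HodgeCM.HermSpace3.signature_ι₁ V, HodgeCM.HermSpace3.posDef_of_ne V⟩ : Summit.HodgeConjecture.CorCM.HermSpace3 ⟨HodgeCM.CMField.K F⟩ ι₁).conj Φ' e₁ (frameD V) (frameD_real V) (frameD_ne V) (Summit.HodgeConjecture.CorCM.HComp.OmegaConj.iotaVConj (Summit.HodgeConjecture.CorCM.DelRec.exists_recordSystem_of_printed hDel) ⟨HodgeCM.CMField.K F⟩ ι₁ (⟨HodgeCM.HermSpace3.Hm V, HodgeCM.HermSpace3.isHermitian V, HodgeCM.HermSpace3.signature_ι₁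 V, HodgeCM.HermSpace3.posDef_of_ne V⟩ : Summit.HodgeConjecture.CorCM.HermSpace3 ⟨HodgeCM.CMField.K F⟩ ι₁) Φ Φ' (frameD V) (ιVE V) (diagonal_frameD_map_complexConj F V)) (2 * imagUnit (HodgeCM.CMField.K F))⁻¹ r').rho ν hν ε' χ' (Summit.HodgeConjecture.CorCM.HComp.OmegaConj.phiConj (Summit.HodgeConjecture.CorCM.DelRec.exists_recordSystem_of_printed hDel) ⟨HodgeCM.CMField.K F⟩ ι₁ (⟨HodgeCM.HermSpace3.Hm V, HodgeCM.HermSpace3.isHermitian V, HodgeCM.HermSpace3.signature_ι₁ V, HodgeCM.HermSpace3.posDef_of_ne V⟩ : Summit.HodgeConjecture.CorCM.HermSpace3 ⟨HodgeCM.CMField.K F⟩ ι₁) Φ Φ' g) (Ω x)),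
      Thm418AsPrinted (toThm418Data (sec42DataOf (Summit.HodgeConjecture.CorCM.DelRec.exists_recordSystem_of_printed hDel) isoOf ⟨HodgeCM.CMField.K F⟩ ι₁ ⟨HodgeCM.HermSpace3.Hm V, HodgeCM.HermSpace3.isHermitian V, HodgeCM.HermSpace3.signature_ι₁ V, HodgeCM.HermSpace3.posDef_of_ne V⟩ Φ)
        ((heckeTranslatesFamilyOf heckeTranslate_definedOver_holds (Summit.HodgeConjecture.CorCM.DelRec.exists_recordSystem_of_printed hDel) isoOf ⟨HodgeCM.CMField.K F⟩ ι₁ ⟨HodgeCM.HermSpace3.Hm V, HodgeCM.HermSpace3.isHermitian V, HodgeCM.HermSpace3.signature_ι₁ V, HodgeCM.HermSpace3.posDef_of_ne V⟩ Φ h6).restOne (AlgHom.id ℚ _) ι₁ hν hw (Def45.Carriers.ofPolDR ν (Def45.PolDR ι₁ hν (Def45.RMuForm ι₁ hν)))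
        (uniformOmegaRep (Summit.HodgeConjecture.CorCM.DelRec.exists_recordSystem_of_printed hDel) ⟨HodgeCM.CMField.K F⟩ ι₁ ⟨HodgeCM.HermSpace3.Hm V, HodgeCM.HermSpace3.isHermitian V, HodgeCM.HermSpace3.signature_ι₁ V, HodgeCM.HermSpace3.posDef_of_ne V⟩ Φ e₁ (frameD V) (frameD_real V) (frameD_ne V) (ιVE V) (2 * imagUnit (HodgeCM.CMField.K F))⁻¹ (fun _ _ => (Rep.update ↥(maximalRealSubfield (HodgeCM.CMField.K F)) (imagUnitSq (HodgeCM.CMField.K F)) (Rep.ofLineOf ↥(maximalRealSubfield (HodgeCM.CMField.K F)) (imagUnitSq (HodgeCM.CMField.K F))) (locF ↥(maximalRealSubfield (HodgeCM.CMField.K F)) (imagUnitSq (HodgeCM.CMField.K F)) (realUnit ⟨HodgeCM.CMField.K F⟩ a.1 a.2.1 a.2.2)) (realUnit ⟨HodgeCM.CMField.K F⟩ a.1 a.2.1 a.2.2) rfl))).Eps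
        (fun e => (uniformOmegaRep (Summit.HodgeConjecture.CorCM.DelRec.exists_recordSystem_of_printed hDel) ⟨HodgeCM.CMField.K F⟩ ι₁ ⟨HodgeCM.HermSpace3.Hm V, HodgeCM.HermSpace3.isHermitian V, HodgeCM.HermSpace3.signature_ι₁ V, HodgeCM.HermSpace3.posDef_of_ne V⟩ Φ e₁ (frameD V) (frameD_real V) (frameD_ne V) (ιVE V) (2 * imagUnit (HodgeCM.CMField.K F))⁻¹ (fun _ _ => (Rep.update ↥(maximalRealSubfield (HodgeCM.CMField.K F)) (imagUnitSq (HodgeCM.CMField.K F)) (Rep.ofLineOf ↥(maximalRealSubfield (HodgeCM.CMField.K F)) (imagUnitSq (HodgeCM.CMField.K F))) (locF ↥(maximalRealSubfield (HodgeCM.CMField.K F)) (imagUnitSq (HodgeCM.CMField.K F)) (realUnit ⟨HodgeCM.CMField.K F⟩ a.1 a.2.1 a.2.2)) (realUnit ⟨HodgeCM.CMField.K F⟩ a.1 a.2.1 a.2.2) rfl))).epsOf (-e))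
        (uniformOmegaRep (Summit.HodgeConjecture.CorCM.DelRec.exists_recordSystem_of_printed hDel) ⟨HodgeCM.CMField.K F⟩ ι₁ ⟨HodgeCM.HermSpace3.Hm V, HodgeCM.HermSpace3.isHermitian V, HodgeCM.HermSpace3.signature_ι₁ V, HodgeCM.HermSpace3.posDef_of_ne V⟩ Φ e₁ (frameD V) (frameD_real V) (frameD_ne V) (ιVE V) (2 * imagUnit (HodgeCM.CMField.K F))⁻¹ (fun _ _ => (Rep.update ↥(maximalRealSubfield (HodgeCM.CMField.K F)) (imagUnitSq (HodgeCM.CMField.K F)) (Rep.ofLineOf ↥(maximalRealSubfield (HodgeCM.CMField.K F)) (imagUnitSq (HodgeCM.CMField.K F))) (locF ↥(maximalRealSubfield (HodgeCM.CMField.K F)) (imagUnitSq (HodgeCM.CMField.K F)) (realUnit ⟨HodgeCM.CMField.K F⟩ a.1 a.2.1 a.2.2)) (realUnit ⟨HodgeCM.CMField.K F⟩ a.1 a.2.1 a.2.2) rfl))).Chi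
        ((uniformOmegaRep (Summit.HodgeConjecture.CorCM.DelRec.exists_recordSystem_of_printed hDel) ⟨HodgeCM.CMField.K F⟩ ι₁ ⟨HodgeCM.HermSpace3.Hm V, HodgeCM.HermSpace3.isHermitian V, HodgeCM.HermSpace3.signature_ι₁ V, HodgeCM.HermSpace3.posDef_of_ne V⟩ Φ e₁ (frameD V) (frameD_real V) (frameD_ne V) (ιVE V) (2 * imagUnit (HodgeCM.CMField.K F))⁻¹ (fun _ _ => (Rep.update ↥(maximalRealSubfield (HodgeCM.CMField.K F)) (imagUnitSq (HodgeCM.CMField.K F)) (Rep.ofLineOf ↥(maximalRealSubfield (HodgeCM.CMField.K F)) (imagUnitSq (HodgeCM.CMField.K F))) (locF ↥(maximalRealSubfield (HodgeCM.CMField.K F)) (imagUnitSq (HodgeCM.CMField.K F)) (realUnit ⟨HodgeCM.CMField.K F⟩ a.1 a.2.1 a.2.2)) (realUnit ⟨HodgeCM.CMField.K F⟩ a.1 a.2.1 a.2.2) rfl))).omega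
        (galConj (IsCMField.complexConj _) ν) hν.galConj)
        ((uniformOmegaRep (Summit.HodgeConjecture.CorCM.DelRec.exists_recordSystem_of_printed hDel) ⟨HodgeCM.CMField.K F⟩ ι₁ ⟨HodgeCM.HermSpace3.Hm V, HodgeCM.HermSpace3.isHermitian V, HodgeCM.HermSpace3.signature_ι₁ V, HodgeCM.HermSpace3.posDef_of_ne V⟩ Φ e₁ (frameD V) (frameD_real V) (frameD_ne V) (ιVE V) (2 * imagUnit (HodgeCM.CMField.K F))⁻¹ (fun _ _ => (Rep.update ↥(maximalRealSubfield (HodgeCM.CMField.K F)) (imagUnitSq (HodgeCM.CMField.K F)) (Rep.ofLineOf ↥(maximalRealSubfield (HodgeCM.CMField.K F)) (imagUnitSq (HodgeCM.CMField.K F))) (locF ↥(maximalRealSubfield (HodgeCM.CMField.K F)) (imagUnitSq (HodgeCM.CMField.K F)) (realUnit ⟨HodgeCM.CMField.K F⟩ a.1 a.2.1 a.2.2)) (realUnit ⟨HodgeCM.CMField.K F⟩ a.1 a.2.1 a.2.2) rfl))).rho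
        (galConj (IsCMField.complexConj _) ν) hν.galConj))))
    -- [Liu21, Def 4.11] ∕ [Prop 4.13] — VERBATIM ✔ p375902 (= ✔ p375090)
    (h411 : ∀ (F : HodgeCM.CMField) [IsGalois ℚ F] (h6 : 6 ≤ Module.finrank ℚ F) {ι₁ : F →+* ℂ} (V : HodgeCM.HermSpace3 F ι₁) (a : RealScalar F)
      (Φ : CMType F) (hΦ : ι₁ ∈ Φ.1) (μ : Literature.NumberTheory.Automorphic.IdeleClassGroup (F : Type) →ₜ* Circle)
      (hμ : IdeleClassGroup.IsConjugateSymplectic (F : Type) μ) (hw : IdeleClassGroup.HasWeight (F : Type) μ 1),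
      Def411AsPrinted (toThm418Data _ (restOfCharDeltaPrime (Summit.HodgeConjecture.CorCM.DelRec.exists_recordSystem_of_printed hDel) ⟨HodgeCM.CMField.K F⟩ h6 ι₁ ⟨HodgeCM.HermSpace3.Hm V, HodgeCM.HermSpace3.isHermitian V, HodgeCM.HermSpace3.signature_ι₁ V, HodgeCM.HermSpace3.posDef_of_ne V⟩ Φ e₁ (frameD V) (frameD_real V) (frameD_ne V) (ιVE V) (Rep.update ↥(maximalRealSubfield (HodgeCM.CMField.K F)) (imagUnitSq (HodgeCM.CMField.K F)) (Rep.ofLineOf ↥(maximalRealSubfield (HodgeCM.CMField.K F)) (imagUnitSq (HodgeCM.CMField.K F))) (locF ↥(maximalRealSubfield (HodgeCM.CMField.K F)) (imagUnitSq (HodgeCM.CMField.K F)) (realUnit ⟨HodgeCM.CMField.K F⟩ a.1 a.2.1 a.2.2)) (realUnit ⟨HodgeCM.CMField.K F⟩ a.1 a.2.1 a.2.2) rfl) μ hμ hw)))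
    (h413 : ∀ (F : HodgeCM.CMField) [IsGalois ℚ F] (h6 : 6 ≤ Module.finrank ℚ F) {ι₁ : F →+* ℂ} (V : HodgeCM.HermSpace3 F ι₁) (a₀ : RealScalar F)
      (Φ : CMType F) (hΦ : ι₁ ∈ Φ.1) (i : (I V (repAt a₀) (muLiu ι₁ GramClass.rep))), Prop413AsPrinted (((uniformOmegaRep (Summit.HodgeConjecture.CorCM.DelRec.exists_recordSystem_of_printed hDel) ⟨HodgeCM.CMField.K F⟩ ι₁ ⟨HodgeCM.HermSpace3.Hm V, HodgeCM.HermSpace3.isHermitian V, HodgeCM.HermSpace3.signature_ι₁ V, HodgeCM.HermSpace3.posDef_of_ne V⟩ Φ e₁ (frameD V) (frameD_real V) (frameD_ne V) (ιVE V) (2 * imagUnit (HodgeCM.CMField.K F))⁻¹ (fun _ _ => (Rep.update ↥(maximalRealSubfield (HodgeCM.CMField.K F)) (imagUnitSq (HodgeCM.CMField.K F)) (Rep.ofLineOf ↥(maximalRealSubfield (HodgeCM.CMField.K F)) (imagUnitSq (HodgeCM.CMField.K F))) (locF ↥(maximalRealSubfield (HodgeCM.CMField.K F)) (imagUnitSq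 (HodgeCM.CMField.K F)) (realUnit ⟨HodgeCM.CMField.K F⟩ (repAt a₀ (Sigma.fst i)).1 (repAt a₀ (Sigma.fst i)).2.1 (repAt a₀ (Sigma.fst i)).2.2)) (realUnit ⟨HodgeCM.CMField.K F⟩ (repAt a₀ (Sigma.fst i)).1 (repAt a₀ (Sigma.fst i)).2.1 (repAt a₀ (Sigma.fst i)).2.2) rfl)))).prop413Data ((liuDictionaryPin exists_isReal_hodgeModel_holds hodgePQ_independent_of_hodgeModel_holds BallQuotient.ballQuotientUniformised_holds (cmAbelianVarietyRealised_of_eigenbasis exists_isReal_hodgeModel_holds hodgePQ_independent_of_hodgeModel_holds cmAbelianVarietyEigenbasisRealised_holds) Literature.NumberTheory.Transcendental.arapura2012_cor_15_4_6_holds V (I V (repAt a₀) (muLiu ι₁ GramClass.rep)) (line V (repAt a₀) (muLiu ι₁ GramClass.rep)))).H))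
    -- [Liu21, App. D Lem D.1 (3)] AS PRINTED per place, read on the INDEXED FAMILY of the tree's own local data at U(J_V)(F⁺_v) of the admissible weight-one triples of 𝕌(a) — scalar-keyed
    (hD3 : ∀ (F : HodgeCM.CMField) [IsGalois ℚ F] (h6 : 6 ≤ Module.finrank ℚ F) {ι₁ : F →+* ℂ} (V : HodgeCM.HermSpace3 F ι₁) (a : RealScalar F)
      (Φ : CMType F) (hΦ : ι₁ ∈ Φ.1) (v : IsDedekindDomain.HeightOneSpectrum (𝓞 ↥(maximalRealSubfield (F : Type)))),
      LemD1_3AsPrintedI (Def411WeilCarriers.localIndexedFamilyAtV (ι := ((μw : {μ : Literature.NumberTheory.Automorphic.IdeleClassGroup (F : Type) →ₜ* Circle // IdeleClassGroup.IsConjugateSymplectic (F : Type) μ ∧ IdeleClassGroup.HasWeight (F : Type) μ 1}) × (toThm418Data _ (restOfCharDeltaPrime (Summit.HodgeConjecture.CorCM.DelRec.exists_recordSystem_of_printed hDel) ⟨HodgeCM.CMField.K F⟩ h6 ι₁ ⟨HodgeCM.HermSpace3.Hm V, HodgeCM.HermSpace3.isHermitian V, HodgeCM.HermSpace3.signature_ι₁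 V, HodgeCM.HermSpace3.posDef_of_ne V⟩ Φ e₁ (frameD V) (frameD_real V) (frameD_ne V) (ιVE V) (Rep.update ↥(maximalRealSubfield (HodgeCM.CMField.K F)) (imagUnitSq (HodgeCM.CMField.K F)) (Rep.ofLineOf ↥(maximalRealSubfield (HodgeCM.CMField.K F)) (imagUnitSq (HodgeCM.CMField.K F))) (locF ↥(maximalRealSubfield (HodgeCM.CMField.K F)) (imagUnitSq (HodgeCM.CMField.K F)) (realUnit ⟨HodgeCM.CMField.K F⟩ a.1 a.2.1 a.2.2)) (realUnit ⟨HodgeCM.CMField.K F⟩ a.1 a.2.1 a.2.2) rfl) μw.1 μw.2.1 μw.2.2)).AdmIndex)) ↥(maximalRealSubfield (F : Type)) (F : Type) (IsCMField.complexConj (F : Type)) 3 e₁ (Matrix.diagonal (frameD V)) (complexConj_imagUnit (F : Type)) (imagUnit_ne_zero (F : Type)) (imagUnit_mul_self (F : Type)) (realDiagonal_isSymm (F : Type) (frameD V) (frameD_real V)) (isUnit_det_realDiagonal (F : Type) (frameD V) (frameD_real V) (frameD_ne V)) (realDiagonal_map (F : Type) (frameD V) (frameD_real V)).symm (le_refl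 3) (fun t => (Rep.update ↥(maximalRealSubfield (HodgeCM.CMField.K F)) (imagUnitSq (HodgeCM.CMField.K F)) (Rep.ofLineOf ↥(maximalRealSubfield (HodgeCM.CMField.K F)) (imagUnitSq (HodgeCM.CMField.K F))) (locF ↥(maximalRealSubfield (HodgeCM.CMField.K F)) (imagUnitSq (HodgeCM.CMField.K F)) (realUnit ⟨HodgeCM.CMField.K F⟩ a.1 a.2.1 a.2.2)) (realUnit ⟨HodgeCM.CMField.K F⟩ a.1 a.2.1 a.2.2) rfl).toFun t.2.1.1) (fun t => t.2.1.2) (fun t => OmegaChiSplitting.chiLocalSplittingsD ⟨HodgeCM.CMField.K F⟩ e₁ (frameD V) (frameD_real V) (frameD_ne V) (toHeckeCharacter (F : Type) t.1.1) ((isOscillatorChar_toHeckeCharacter_iff t.1.1).mpr t.1.2.1) ((Rep.update ↥(maximalRealSubfield (HodgeCM.CMField.K F)) (imagUnitSq (HodgeCM.CMField.K F)) (Rep.ofLineOf ↥(maximalRealSubfield (HodgeCM.CMField.K F)) (imagUnitSq (HodgeCM.CMField.K F))) (locF ↥(maximalRealSubfield (HodgeCM.CMField.K F)) (imagUnitSq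 (HodgeCM.CMField.K F)) (realUnit ⟨HodgeCM.CMField.K F⟩ a.1 a.2.1 a.2.2)) (realUnit ⟨HodgeCM.CMField.K F⟩ a.1 a.2.1 a.2.2) rfl).toFun t.2.1.1)) (fun t => localMu (F : Type) (toHeckeCharacter (F : Type) t.1.1)) (fun t v x => norm_localMu (F : Type) (toHeckeCharacter (F : Type) t.1.1) v (isUnitary_toHeckeCharacter (F : Type) t.1.1) x) (fun t => continuous_localMu (F : Type) (toHeckeCharacter (F : Type) t.1.1)) (fun t v x => localMu_toLocalRing_eq_one_iff (F : Type) (toHeckeCharacter (F : Type) t.1.1) v ((isOscillatorChar_toHeckeCharacter_iff t.1.1).mpr t.1.2.1) x) v))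
    -- [Liu21, App. D Lem D.1 (1)] AS PRINTED per place at the local data of 𝔯δ′⟦a, μ⟧ — VERBATIM ✔ p375902, UNGUARDED
    (hD1'' : ∀ (F : HodgeCM.CMField) [IsGalois ℚ F] (h6 : 6 ≤ Module.finrank ℚ F) {ι₁ : F →+* ℂ} (V : HodgeCM.HermSpace3 F ι₁) (a : RealScalar F)
      (Φ : CMType F) (hΦ : ι₁ ∈ Φ.1) (μ : Literature.NumberTheory.Automorphic.IdeleClassGroup (F : Type) →ₜ* Circle)
      (hμ : IdeleClassGroup.IsConjugateSymplectic (F : Type) μ) (hw : IdeleClassGroup.HasWeight (F : Type) μ 1)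
      (j : (toThm418Data _ (restOfCharDeltaPrime (Summit.HodgeConjecture.CorCM.DelRec.exists_recordSystem_of_printed hDel) ⟨HodgeCM.CMField.K F⟩ h6 ι₁ ⟨HodgeCM.HermSpace3.Hm V, HodgeCM.HermSpace3.isHermitian V, HodgeCM.HermSpace3.signature_ι₁ V, HodgeCM.HermSpace3.posDef_of_ne V⟩ Φ e₁ (frameD V) (frameD_real V) (frameD_ne V) (ιVE V) (Rep.update ↥(maximalRealSubfield (HodgeCM.CMField.K F)) (imagUnitSq (HodgeCM.CMField.K F)) (Rep.ofLineOf ↥(maximalRealSubfield (HodgeCM.CMField.K F)) (imagUnitSq (HodgeCM.CMField.K F))) (locF ↥(maximalRealSubfield (HodgeCM.CMField.K F)) (imagUnitSq (HodgeCM.CMField.K F)) (realUnit ⟨HodgeCM.CMField.K F⟩ a.1 a.2.1 a.2.2)) (realUnit ⟨HodgeCM.CMField.K F⟩ a.1 a.2.1 a.2.2) rfl) μ hμ hw)).AdmIndex) (v : IsDedekindDomain.HeightOneSpectrum (𝓞 ↥(maximalRealSubfield (F : Type)))),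
      LemD1_1AsPrinted
        (Def411WeilCarriers.localLemD1Data ↥(maximalRealSubfield (F : Type)) (F : Type) (IsCMField.complexConj (F : Type)) 3 e₁
          (Matrix.diagonal (frameD V)) (complexConj_imagUnit (F : Type)) (imagUnit_ne_zero (F : Type)) (imagUnit_mul_self (F : Type))
          (realDiagonal_isSymm (F : Type) (frameD V) (frameD_real V)) (isUnit_det_realDiagonal (F : Type) (frameD V) (frameD_real V) (frameD_ne V))
          (realDiagonal_map (F : Type) (frameD V) (frameD_real V)).symm (((Rep.update ↥(maximalRealSubfield (HodgeCM.CMField.K F)) (imagUnitSq (HodgeCM.CMField.K F)) (Rep.ofLineOf ↥(maximalRealSubfield (HodgeCM.CMField.K F)) (imagUnitSq (HodgeCM.CMField.K F))) (locF ↥(maximalRealSubfield (HodgeCM.CMField.K F)) (imagUnitSq (HodgeCM.CMField.K F)) (realUnit ⟨HodgeCM.CMField.K F⟩ a.1 a.2.1 a.2.2)) (realUnit ⟨HodgeCM.CMField.K F⟩ a.1 a.2.1 a.2.2) rfl)).toFun j.1.1)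
          (OmegaChiSplitting.chiLocalSplittingsD ⟨HodgeCM.CMField.K F⟩ e₁ (frameD V) (frameD_real V) (frameD_ne V) (toHeckeCharacter (F : Type) μ)
            ((isOscillatorChar_toHeckeCharacter_iff μ).mpr hμ) (((Rep.update ↥(maximalRealSubfield (HodgeCM.CMField.K F)) (imagUnitSq (HodgeCM.CMField.K F)) (Rep.ofLineOf ↥(maximalRealSubfield (HodgeCM.CMField.K F)) (imagUnitSq (HodgeCM.CMField.K F))) (locF ↥(maximalRealSubfield (HodgeCM.CMField.K F)) (imagUnitSq (HodgeCM.CMField.K F)) (realUnit ⟨HodgeCM.CMField.K F⟩ a.1 a.2.1 a.2.2)) (realUnit ⟨HodgeCM.CMField.K F⟩ a.1 a.2.1 a.2.2) rfl)).toFun j.1.1))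
          (le_refl 3) (localMu (F : Type) (toHeckeCharacter (F : Type) μ))
          (fun v x => norm_localMu (F : Type) (toHeckeCharacter (F : Type) μ) v (isUnitary_toHeckeCharacter (F : Type) μ) x)
          (continuous_localMu (F : Type) (toHeckeCharacter (F : Type) μ))
          (fun v t => localMu_toLocalRing_eq_one_iff (F : Type) (toHeckeCharacter (F : Type) μ) v ((isOscillatorChar_toHeckeCharacter_iff μ).mpr hμ) t)
          j.1.2.1
          (Def411WeilCarriers.norm_chi_eq_one ↥(maximalRealSubfield (F : Type)) (F : Type) (IsCMField.complexConj (F : Type))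
            (Algebra.IsQuadraticExtension.finrank_eq_two ↥(maximalRealSubfield (F : Type)) (F : Type))
            (UnitaryGroup.algEquiv_ne_one_of_apply_eq_neg ↥(maximalRealSubfield (F : Type)) (F : Type) (IsCMField.complexConj (F : Type))
              (complexConj_imagUnit (F : Type)) (imagUnit_ne_zero (F : Type))) j.1.2)
          j.1.2.2.1 v))
    : HC_CM :=
  Summit.HodgeConjecture.CorCM.D2Bridge.MuKeyIdentLemD3End.hc_cm_of_printed_citations_muKey_ident_lemD3
    (Summit.HodgeConjecture.CorCM.DelRec.exists_recordSystem_of_printed hDel) h21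
    (fun F hG h6 {ι₁} V a Φ hΦ ν hν hw => by
      haveI : IsGalois ℚ F := hG
      -- the identification binder DISCHARGED IN KERNEL: RSCONJ row R6 over `Model.RecordSystemConj.exists_conj` (module `HComp.RecordSystemConj`)
      obtain ⟨R', hR'⟩ :=
        Summit.HodgeConjecture.CorCM.D2Bridge.MuConjIdent.exists_recordSystemConj_X_sec42DataOf_levelOf_eq
          (Summit.HodgeConjecture.CorCM.DelRec.exists_recordSystem_of_printed hDel)
          (⟨HodgeCM.HermSpace3.Hm V, HodgeCM.HermSpace3.isHermitian V, HodgeCM.HermSpace3.signature_ι₁ V, HodgeCM.HermSpace3.posDef_of_ne V⟩ : Summit.HodgeConjecture.CorCM.HermSpace3 ⟨HodgeCM.CMField.K F⟩ ι₁) Φ isoOf h6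
      exact hLiu418 F h6 V a Φ hΦ ν hν hw R' hR' (fun Φ' r' ε ε' hε χ χ' hχ =>
        -- the ω-side binder DISCHARGED IN KERNEL: ident-1's Ω (M) over Parts III–V + L6′ (module `HComp.RecordSystemConjOmegaTwistModel`)
        Summit.HodgeConjecture.CorCM.HComp.OmegaConj.exists_uniformOmegaRep_conj_hermConj (Summit.HodgeConjecture.CorCM.DelRec.exists_recordSystem_of_printed hDel) ⟨HodgeCM.CMField.K F⟩ ι₁
          (⟨HodgeCM.HermSpace3.Hm V, HodgeCM.HermSpace3.isHermitian V, HodgeCM.HermSpace3.signature_ι₁ V, HodgeCM.HermSpace3.posDef_of_ne V⟩ : Summit.HodgeConjecture.CorCM.HermSpace3 ⟨HodgeCM.CMField.K F⟩ ι₁) Φ Φ' e₁ (frameD V) (ιVE V) (2 * imagUnit (HodgeCM.CMField.K F))⁻¹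
          (fun _ _ => (Rep.update ↥(maximalRealSubfield (HodgeCM.CMField.K F)) (imagUnitSq (HodgeCM.CMField.K F)) (Rep.ofLineOf ↥(maximalRealSubfield (HodgeCM.CMField.K F)) (imagUnitSq (HodgeCM.CMField.K F))) (locF ↥(maximalRealSubfield (HodgeCM.CMField.K F)) (imagUnitSq (HodgeCM.CMField.K F)) (realUnit ⟨HodgeCM.CMField.K F⟩ a.1 a.2.1 a.2.2)) (realUnit ⟨HodgeCM.CMField.K F⟩ a.1 a.2.1 a.2.2) rfl)) r' (frameD_real V) (frameD_ne V) (diagonal_frameD_map_complexConj F V) ν hν ε ε' hε χ χ' hχ))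
    h411 h413 hD3 hD1''

end Summit.HodgeConjecture.CorCM.D2Bridge.MuKeyIdentLemD3DelRecConjOmegaEnd

end
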